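import Mathlib
import HarnessLib
import Summits.AtomisticToContinuum.Crystallization.Theorems.PricedLinkCensusSoftFourRingsLocalAB
import Summits.AtomisticToContinuum.Crystallization.Theorems.PricedLinkCensusSoftFourRingsApex
import Summits.AtomisticToContinuum.Crystallization.Theorems.PricedLinkCensusSoftFourRingsPosition

/-!
# Soft four-rings: the block of a slack triangle

Support file for `SoftFourRings` (route `PricedLinkCensus`, sub-problem `Crystallization`).

`slack_block` (conditional on Tammes-13): in the tight regime, a slack triangle `{a, b, c}` (bond
`ab`, non-bond sides `ca`, `cb`) determines ten named vertices with
`N(a) = {p, u, r, b}`, `N(b) = {q, u', r, a}`, `N(c) = {p, m', m, q}`, `N(r) = {a, b, u, u'}`,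
`N(p) = {a, u, c, m'}`, `N(q) = {b, u', c, m}`, the fans `p–u–r–b`, `q–u'–r–a`, `p–m'–m–q`,
`u–a–b–u'` (chords outside `B`), `t_r = 3`, `t_p = t_q = 2`.
-/

namespace Summit.AtomisticToContinuum.Crystallization.Theorems

open Real RealInnerProductSpace Literature.Geometry.DiscreteGeometry

section Setting

variable {X : Finset (EuclideanSpace ℝ (Fin 3))} {B : Finset (Finset (EuclideanSpace ℝ (Fin 3)))}
  (hT : musinTarasov2012_tammes_thirteen) (hX1 : ∀ y ∈ X, ‖y‖ = 1) (hcard : X.card = 12)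
  (hsepX : ∀ u ∈ X, ∀ u' ∈ X, u ≠ u' → ⟪u, u'⟫ ≤ 1 - 1 / (2 * (101 / 100 : ℝ) ^ 2))
  (hB : ∀ T ∈ B, ∃ u ∈ X, ∃ u' ∈ X, u ≠ u' ∧ 1 - (101 / 100 : ℝ) ^ 2 / 2 ≤ ⟪u, u'⟫ ∧ T = {u, u'})
  (hBcard : B.card = 24)
  (hdeg : ∀ v ∈ X, ∃ w : Fin 4 → EuclideanSpace ℝ (Fin 3), (∀ k, w k ∈ X) ∧
    Function.Injective w ∧ (∀ k, w k ≠ v) ∧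
    (∀ k, ({v, w k} : Finset (EuclideanSpace ℝ (Fin 3))) ∈ B) ∧
    ∀ y, ({v, y} : Finset (EuclideanSpace ℝ (Fin 3))) ∈ B → ∃ k, y = w k)

include hT hX1 hcard hsepX hB hBcard hdeg in
open scoped Classical in
/-- **The block of a slack triangle, first part**: everything except the apices' data, plus the
two end triangles. -/
theorem slack_block_core {cf : EuclideanSpace ℝ (Fin 3)} (hcfF : cf ∈ facetNormals X)
    (hcf3 : (tightSet X cf).card = 3)
    (hcfnb : ((edgesOfFacet X cf).filter (fun T => T ∉ B)).card = 2)
    {a b c : EuclideanSpace ℝ (Fin 3)} (hTabc : tightSet X cf = {a, b, c})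
    (hab : ({a, b} : Finset (EuclideanSpace ℝ (Fin 3))) ∈ B)
    (hca : ({c, a} : Finset (EuclideanSpace ℝ (Fin 3))) ∉ B)
    (hcb : ({c, b} : Finset (EuclideanSpace ℝ (Fin 3))) ∉ B) :
    ∃ p q u u' m m' r : EuclideanSpace ℝ (Fin 3),
      (p ∈ X ∧ q ∈ X ∧ u ∈ X ∧ u' ∈ X ∧ m ∈ X ∧ m' ∈ X ∧ r ∈ X) ∧
      (∀ y, ({a, y} : Finset (EuclideanSpace ℝ (Fin 3))) ∈ B ↔ (y = p ∨ y = u ∨ y = r ∨ y = b)) ∧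
      (∀ y, ({b, y} : Finset (EuclideanSpace ℝ (Fin 3))) ∈ B ↔ (y = q ∨ y = u' ∨ y = r ∨ y = a)) ∧
      (∀ y, ({c, y} : Finset (EuclideanSpace ℝ (Fin 3))) ∈ B ↔ (y = p ∨ y = m' ∨ y = m ∨ y = q)) ∧
      (∀ y, ({r, y} : Finset (EuclideanSpace ℝ (Fin 3))) ∈ B ↔ (y = u ∨ y = a ∨ y = b ∨ y = u')) ∧
      -- fan bonds
      (({p, u} : Finset (EuclideanSpace ℝ (Fin 3))) ∈ B ∧ ({u, r} : Finset _) ∈ B ∧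
        ({r, b} : Finset _) ∈ B ∧ ({q, u'} : Finset _) ∈ B ∧ ({u', r} : Finset _) ∈ B ∧
        ({p, m'} : Finset _) ∈ B ∧ ({m', m} : Finset _) ∈ B ∧ ({m, q} : Finset _) ∈ B) ∧
      -- chords outside `B`
      (({p, r} : Finset (EuclideanSpace ℝ (Fin 3))) ∉ B ∧ ({u, b} : Finset _) ∉ B ∧
        ({p, b} : Finset _) ∉ B ∧ ({q, r} : Finset _) ∉ B ∧ ({u', a} : Finset _) ∉ B ∧
        ({q, a} : Finset _) ∉ B ∧ ({p, m} : Finset _) ∉ B ∧ ({m', q} : Finset _) ∉ B ∧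
        ({p, q} : Finset _) ∉ B ∧ ({u, u'} : Finset _) ∉ B) ∧
      -- distinctness inside the four fans
      ((p ≠ u ∧ p ≠ r ∧ p ≠ b ∧ u ≠ r ∧ u ≠ b ∧ r ≠ b) ∧
        (q ≠ u' ∧ q ≠ r ∧ q ≠ a ∧ u' ≠ r ∧ u' ≠ a ∧ r ≠ a) ∧
        (p ≠ m' ∧ p ≠ m ∧ p ≠ q ∧ m' ≠ m ∧ m' ≠ q ∧ m ≠ q) ∧
        (u ≠ a ∧ u ≠ b ∧ u ≠ u' ∧ a ≠ b ∧ a ≠ u' ∧ b ≠ u') ∧ r ≠ c) ∧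
      -- bond-triangle count at `r`
      ((facetNormals X).filter (fun c' => r ∈ tightSet X c' ∧ (tightSet X c').card = 3 ∧
        ((edgesOfFacet X c').filter (fun T => T ∉ B)).card = 0)).card = 3 ∧
      (∃ g ∈ facetNormals X, tightSet X g = {c, p, a}) ∧
      (∃ g' ∈ facetNormals X, tightSet X g' = {c, q, b}) := by
  have h0 : (0 : EuclideanSpace ℝ (Fin 3)) ∈ interior (convexHull ℝ (X : Set (EuclideanSpace ℝ (Fin 3)))) :=
    zero_mem_interior_convexHull_of_twelve_le_card hT hX1 hcard.ge
      (ca := 1 - 1 / (2 * (101 / 100 : ℝ) ^ 2)) (by norm_num) hsepX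
  obtain ⟨-, hC1, -, hC3, -⟩ := tight_counts_one_percent hT hX1 hcard hsepX hB hBcard hdeg
  obtain ⟨hab', hac, hbc⟩ := card_three_distinct (hTabc ▸ hcf3)
  have haT : a ∈ tightSet X cf := by rw [hTabc]; simp
  have hbT : b ∈ tightSet X cf := by rw [hTabc]; simp
  have hcT : c ∈ tightSet X cf := by rw [hTabc]; simp
  have haX : a ∈ X := (mem_tightSet.1 haT).1
  have hbX : b ∈ X := (mem_tightSet.1 hbT).1
  have hta := hC3 cf hcfF hcf3 hcfnb a haT
  have htb := hC3 cf hcfF hcf3 hcfnb b hbT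
  -- the isolated vertex `c`
  obtain ⟨w, hwX, hwinj, hwc, hcw, hconly, hB01, hB12, hB23, hB02, hB13, hB03, hpa, hqb,
    ⟨g, hgF, hgT, hgnb⟩, ⟨g', hg'F, hg'T, hg'nb⟩⟩ :=
    slack_c_vertex hT hX1 hcard hsepX hB hBcard hdeg hcfF hcf3 hcfnb hTabc hca hcb
  have hw01 : w 0 ≠ w 1 := fun h => by simpa using hwinj h
  have hw02 : w 0 ≠ w 2 := fun h => by simpa using hwinj h
  have hw03 : w 0 ≠ w 3 := fun h => by simpa using hwinj h
  have hw12 : w 1 ≠ w 2 := fun h => by simpa using hwinj h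
  have hw13 : w 1 ≠ w 3 := fun h => by simpa using hwinj h
  have hw23 : w 2 ≠ w 3 := fun h => by simpa using hwinj h
  have hNc : ∀ y, ({c, y} : Finset (EuclideanSpace ℝ (Fin 3))) ∈ B ↔
      (y = w 0 ∨ y = w 1 ∨ y = w 2 ∨ y = w 3) := by
    intro y
    rw [← exists_fin_four_iff w y]
    exact ⟨hconly y, by rintro ⟨k, rfl⟩; exact hcw k⟩
  have hbp : b ≠ w 0 := fun h => hcb (h ▸ hcw 0)
  have haq : a ≠ w 3 := fun h => hca (h ▸ hcw 3)
  have hsab : ({a, b} : Finset (EuclideanSpace ℝ (Fin 3))) ⊆ tightSet X cf := by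
    rw [hTabc]; exact pair_subset_three_left _ _ _
  have hsba : ({b, a} : Finset (EuclideanSpace ℝ (Fin 3))) ⊆ tightSet X cf := by
    rw [Finset.pair_comm]; exact hsab
  have hsap : ({a, w 0} : Finset (EuclideanSpace ℝ (Fin 3))) ⊆ tightSet X g := by
    rw [hgT]; intro x hx
    rw [Finset.mem_insert, Finset.mem_singleton] at hx
    rw [Finset.mem_insert, Finset.mem_insert, Finset.mem_singleton]
    rcases hx with rfl | rfl
    exacts [Or.inr (Or.inr rfl), Or.inr (Or.inl rfl)]
  have hsbq : ({b, w 3} : Finset (EuclideanSpace ℝ (Fin 3))) ⊆ tightSet X g' := by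
    rw [hg'T]; intro x hx
    rw [Finset.mem_insert, Finset.mem_singleton] at hx
    rw [Finset.mem_insert, Finset.mem_insert, Finset.mem_singleton]
    rcases hx with rfl | rfl
    exacts [Or.inr (Or.inr rfl), Or.inr (Or.inl rfl)]
  have hn2 : ((edgesOfFacet X cf).filter (fun T => T ∉ B)).card ≠ 0 := by rw [hcfnb]; decide
  have hng : ((edgesOfFacet X g).filter (fun T => T ∉ B)).card ≠ 0 := by rw [hgnb]; decide
  have hng' : ((edgesOfFacet X g').filter (fun T => T ∉ B)).card ≠ 0 := by rw [hg'nb]; decide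
  -- the bonded vertices `a` and `b`
  obtain ⟨u, r, huX, hrX, hNa, hpu, hpr, hpb, hur, hub, hrb, hua, hra, hBpu, hBur, hBrb, hBpr, hBub,
    hBpb⟩ :=
    slack_ab_vertex hT hX1 hcard hsepX hB hBcard hdeg haX hta hab (by rw [Finset.pair_comm]; exact hpa)
      hbp ⟨cf, hcfF, hsab, hn2⟩ ⟨g, hgF, hsap, hng⟩
  obtain ⟨u', r', hu'X, hr'X, hNb, hqu', hqr', hqa, hu'r', hu'a, hr'a, hu'b, hr'b, hBqu', hBu'r',
    hBr'a, hBqr', hBu'a, hBqa⟩ :=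
    slack_ab_vertex hT hX1 hcard hsepX hB hBcard hdeg hbX htb (by rw [Finset.pair_comm]; exact hab)
      (by rw [Finset.pair_comm]; exact hqb) haq ⟨cf, hcfF, hsba, hn2⟩ ⟨g', hg'F, hsbq, hng'⟩
  -- the two apices coincide
  have har : ({a, r} : Finset (EuclideanSpace ℝ (Fin 3))) ∈ B :=
    (hNa r).2 (Or.inr (Or.inr (Or.inl rfl)))
  have hrr' : r = r' := by
    have hbr : ({b, r} : Finset (EuclideanSpace ℝ (Fin 3))) ∈ B := by
      rw [Finset.pair_comm]; exact hBrb
    rcases (hNb r).1 hbr with e | e | e | e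
    · exact absurd (by rw [← e, Finset.pair_comm]; exact har) hBqa
    · exact absurd (by rw [← e, Finset.pair_comm]; exact har) hBu'a
    · exact e
    · exact absurd e hra
  subst hrr'
  have hau : ({a, u} : Finset (EuclideanSpace ℝ (Fin 3))) ∈ B := (hNa u).2 (Or.inr (Or.inl rfl))
  have hbu' : ({b, u'} : Finset (EuclideanSpace ℝ (Fin 3))) ∈ B := (hNb u').2 (Or.inr (Or.inl rfl))
  have huu' : u ≠ u' := fun h => hBu'a (by rw [← h, Finset.pair_comm]; exact hau)
  have hru : ({r, u} : Finset (EuclideanSpace ℝ (Fin 3))) ∈ B := by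
    rw [Finset.pair_comm]; exact hBur
  have hra' : ({r, a} : Finset (EuclideanSpace ℝ (Fin 3))) ∈ B := by
    rw [Finset.pair_comm]; exact har
  have hru' : ({r, u'} : Finset (EuclideanSpace ℝ (Fin 3))) ∈ B := by
    rw [Finset.pair_comm]; exact hBu'r'
  -- `N(r) = {u, a, b, u'}`
  have hNr : ∀ y, ({r, y} : Finset (EuclideanSpace ℝ (Fin 3))) ∈ B ↔
      (y = u ∨ y = a ∨ y = b ∨ y = u') := by
    intro y
    refine (partners_iff_of_four hdeg hrX ![u, a, b, u']
      (injective_vec4 hua hub huu' hab' hu'a.symm hu'b.symm) ?_ y).trans ?_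
    swap
    · rw [exists_fin_four_iff]
      simp only [Fin.isValue, Matrix.cons_val_zero, Matrix.cons_val_one, Matrix.cons_val]
    intro k
    fin_cases k
    exacts [hru, hra', hBrb, hru']
  have hrc : r ≠ c := fun h => hca (by rw [Finset.pair_comm, ← h]; exact har)
  -- `t_r = 3` and `{u, u'} ∉ B`
  obtain ⟨e₁, he₁, he₁T⟩ := exists_bt_at hX1 hsepX hB hru (by rw [Finset.pair_comm]; exact hau) hra'
  obtain ⟨e₂, he₂, he₂T⟩ := exists_bt_at hX1 hsepX hB hra' hab hBrb
  obtain ⟨e₃, he₃, he₃T⟩ := exists_bt_at hX1 hsepX hB hBrb hbu' hru'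
  have hb1 : b ∉ tightSet X e₁ := by rw [he₁T]; exact not_mem_three hrb.symm hub.symm hab'.symm
  have ha3 : a ∉ tightSet X e₃ := by rw [he₃T]; exact not_mem_three hra.symm hab' hu'a.symm
  have hb2 : b ∈ tightSet X e₂ := by rw [he₂T]; simp
  have ha2 : a ∈ tightSet X e₂ := by rw [he₂T]; simp
  have hb3 : b ∈ tightSet X e₃ := by rw [he₃T]; simp
  have h12 : e₁ ≠ e₂ := fun h => hb1 (h ▸ hb2)
  have h13 : e₁ ≠ e₃ := fun h => hb1 (h ▸ hb3)
  have h23 : e₂ ≠ e₃ := fun h => ha3 (h ▸ ha2)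
  have htr3 : 3 ≤ ((facetNormals X).filter (fun c' => r ∈ tightSet X c' ∧ (tightSet X c').card = 3 ∧
      ((edgesOfFacet X c').filter (fun T => T ∉ B)).card = 0)).card := by
    have := le_tv_of_subset (X := X) (B := B) (v := r) (S := {e₁, e₂, e₃}) (by
      intro e he
      rw [Finset.mem_insert, Finset.mem_insert, Finset.mem_singleton] at he
      rcases he with rfl | rfl | rfl
      exacts [he₁, he₂, he₃])
    rwa [Finset.card_eq_three.2 ⟨e₁, e₂, e₃, h12, h13, h23, rfl⟩] at this
  have htr : ((facetNormals X).filter (fun c' => r ∈ tightSet X c' ∧ (tightSet X c').card = 3 ∧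
      ((edgesOfFacet X c').filter (fun T => T ∉ B)).card = 0)).card = 3 := by
    rcases hC1 r hrX with h | h <;> omega
  have hBuu' : ({u, u'} : Finset (EuclideanSpace ℝ (Fin 3))) ∉ B := by
    intro h
    obtain ⟨e₄, he₄, he₄T⟩ := exists_bt_at hX1 hsepX hB hru h hru'
    have hu'1 : u' ∉ tightSet X e₁ := by rw [he₁T]; exact not_mem_three hu'r' huu'.symm hu'a
    have hu2 : u ∉ tightSet X e₂ := by rw [he₂T]; exact not_mem_three hur hua hub
    have hu3 : u ∉ tightSet X e₃ := by rw [he₃T]; exact not_mem_three hur hub huu'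
    have hu4 : u ∈ tightSet X e₄ := by rw [he₄T]; simp
    have hu'4 : u' ∈ tightSet X e₄ := by rw [he₄T]; simp
    have h14 : e₁ ≠ e₄ := fun h => hu'1 (h ▸ hu'4)
    have h24 : e₂ ≠ e₄ := fun h => hu2 (h ▸ hu4)
    have h34 : e₃ ≠ e₄ := fun h => hu3 (h ▸ hu4)
    have := le_tv_of_subset (X := X) (B := B) (v := r) (S := {e₁, e₂, e₃, e₄}) (by
      intro e he
      rw [Finset.mem_insert, Finset.mem_insert, Finset.mem_insert, Finset.mem_singleton] at he
      rcases he with rfl | rfl | rfl | rfl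
      exacts [he₁, he₂, he₃, he₄])
    have hnot : e₁ ∉ ({e₂, e₃, e₄} : Finset (EuclideanSpace ℝ (Fin 3))) := not_mem_three h12 h13 h14
    have h4 : ({e₁, e₂, e₃, e₄} : Finset (EuclideanSpace ℝ (Fin 3))).card = 4 := by
      rw [Finset.card_insert_of_notMem hnot,
        Finset.card_eq_three.2 ⟨e₂, e₃, e₄, h23, h24, h34, rfl⟩]
    rw [h4] at this
    omega
  exact ⟨w 0, w 3, u, u', w 2, w 1, r, ⟨hwX 0, hwX 3, huX, hu'X, hwX 2, hwX 1, hrX⟩, hNa, hNb, hNc,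
    hNr, ⟨hBpu, hBur, hBrb, hBqu', hBu'r', hB01, hB12, hB23⟩,
    ⟨hBpr, hBub, hBpb, hBqr', hBu'a, hBqa, hB02, hB13, hB03, hBuu'⟩,
    ⟨⟨hpu, hpr, hpb, hur, hub, hrb⟩, ⟨hqu', hqr', hqa, hu'r', hu'a, hr'a⟩,
      ⟨hw01, hw02, hw03, hw12, hw13, hw23⟩, ⟨hua, hub, huu', hab', hu'a.symm, hu'b.symm⟩, hrc⟩,
    htr, ⟨g, hgF, hgT⟩, ⟨g', hg'F, hg'T⟩⟩

include hT hX1 hcard hsepX hB hBcard hdeg in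
open scoped Classical in
/-- **The block of a slack triangle** (see the module docstring). -/
theorem slack_block {cf : EuclideanSpace ℝ (Fin 3)} (hcfF : cf ∈ facetNormals X)
    (hcf3 : (tightSet X cf).card = 3)
    (hcfnb : ((edgesOfFacet X cf).filter (fun T => T ∉ B)).card = 2)
    {a b c : EuclideanSpace ℝ (Fin 3)} (hTabc : tightSet X cf = {a, b, c})
    (hab : ({a, b} : Finset (EuclideanSpace ℝ (Fin 3))) ∈ B)
    (hca : ({c, a} : Finset (EuclideanSpace ℝ (Fin 3))) ∉ B)
    (hcb : ({c, b} : Finset (EuclideanSpace ℝ (Fin 3))) ∉ B) :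
    ∃ p q u u' m m' r : EuclideanSpace ℝ (Fin 3),
      (p ∈ X ∧ q ∈ X ∧ u ∈ X ∧ u' ∈ X ∧ m ∈ X ∧ m' ∈ X ∧ r ∈ X) ∧
      (∀ y, ({a, y} : Finset (EuclideanSpace ℝ (Fin 3))) ∈ B ↔ (y = p ∨ y = u ∨ y = r ∨ y = b)) ∧
      (∀ y, ({b, y} : Finset (EuclideanSpace ℝ (Fin 3))) ∈ B ↔ (y = q ∨ y = u' ∨ y = r ∨ y = a)) ∧
      (∀ y, ({c, y} : Finset (EuclideanSpace ℝ (Fin 3))) ∈ B ↔ (y = p ∨ y = m' ∨ y = m ∨ y = q)) ∧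
      (∀ y, ({r, y} : Finset (EuclideanSpace ℝ (Fin 3))) ∈ B ↔ (y = u ∨ y = a ∨ y = b ∨ y = u')) ∧
      -- fan bonds
      (({p, u} : Finset (EuclideanSpace ℝ (Fin 3))) ∈ B ∧ ({u, r} : Finset _) ∈ B ∧
        ({r, b} : Finset _) ∈ B ∧ ({q, u'} : Finset _) ∈ B ∧ ({u', r} : Finset _) ∈ B ∧
        ({p, m'} : Finset _) ∈ B ∧ ({m', m} : Finset _) ∈ B ∧ ({m, q} : Finset _) ∈ B) ∧
      -- chords outside `B`
      (({p, r} : Finset (EuclideanSpace ℝ (Fin 3))) ∉ B ∧ ({u, b} : Finset _) ∉ B ∧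
        ({p, b} : Finset _) ∉ B ∧ ({q, r} : Finset _) ∉ B ∧ ({u', a} : Finset _) ∉ B ∧
        ({q, a} : Finset _) ∉ B ∧ ({p, m} : Finset _) ∉ B ∧ ({m', q} : Finset _) ∉ B ∧
        ({p, q} : Finset _) ∉ B ∧ ({u, u'} : Finset _) ∉ B) ∧
      -- distinctness inside the four fans
      ((p ≠ u ∧ p ≠ r ∧ p ≠ b ∧ u ≠ r ∧ u ≠ b ∧ r ≠ b) ∧
        (q ≠ u' ∧ q ≠ r ∧ q ≠ a ∧ u' ≠ r ∧ u' ≠ a ∧ r ≠ a) ∧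
        (p ≠ m' ∧ p ≠ m ∧ p ≠ q ∧ m' ≠ m ∧ m' ≠ q ∧ m ≠ q) ∧
        (u ≠ a ∧ u ≠ b ∧ u ≠ u' ∧ a ≠ b ∧ a ≠ u' ∧ b ≠ u') ∧ r ≠ c) ∧
      -- bond-triangle count at `r`
      ((facetNormals X).filter (fun c' => r ∈ tightSet X c' ∧ (tightSet X c').card = 3 ∧
        ((edgesOfFacet X c').filter (fun T => T ∉ B)).card = 0)).card = 3 ∧
      (∀ y, ({p, y} : Finset (EuclideanSpace ℝ (Fin 3))) ∈ B ↔ (y = a ∨ y = u ∨ y = c ∨ y = m')) ∧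
      (∀ y, ({q, y} : Finset (EuclideanSpace ℝ (Fin 3))) ∈ B ↔ (y = b ∨ y = u' ∨ y = c ∨ y = m)) ∧
      ((facetNormals X).filter (fun c' => p ∈ tightSet X c' ∧ (tightSet X c').card = 3 ∧
        ((edgesOfFacet X c').filter (fun T => T ∉ B)).card = 0)).card = 2 ∧
      ((facetNormals X).filter (fun c' => q ∈ tightSet X c' ∧ (tightSet X c').card = 3 ∧
        ((edgesOfFacet X c').filter (fun T => T ∉ B)).card = 0)).card = 2 := by
  obtain ⟨hab', hac, hbc⟩ := card_three_distinct (hTabc ▸ hcf3)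
  have hcT : c ∈ tightSet X cf := by rw [hTabc]; simp
  have hcX : c ∈ X := (mem_tightSet.1 hcT).1
  obtain ⟨p, q, u, u', m, m', r, ⟨hpX, hqX, huX, hu'X, hmX, hm'X, hrX⟩, hNa, hNb, hNc, hNr,
    ⟨hBpu, hBur, hBrb, hBqu', hBu'r, hBpm', hBm'm, hBmq⟩,
    ⟨hBpr, hBub, hBpb, hBqr, hBu'a, hBqa, hBpm, hBm'q, hBpq, hBuu'⟩,
    ⟨⟨hpu, hpr, hpb, hur, hub, hrb⟩, ⟨hqu', hqr, hqa, hu'r, hu'a, hra⟩,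
      ⟨hpm', hpm, hpq, hm'm, hm'q, hmq⟩, ⟨hua, -, huu', -, hau', hbu'⟩, hrc⟩,
    htr, ⟨g, hgF, hgT⟩, ⟨g', hg'F, hg'T⟩⟩ :=
    slack_block_core hT hX1 hcard hsepX hB hBcard hdeg hcfF hcf3 hcfnb hTabc hab hca hcb
  have hau : ({a, u} : Finset (EuclideanSpace ℝ (Fin 3))) ∈ B := (hNa u).2 (Or.inr (Or.inl rfl))
  have hbu'' : ({b, u'} : Finset (EuclideanSpace ℝ (Fin 3))) ∈ B := (hNb u').2 (Or.inr (Or.inl rfl))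
  have hmc : m ≠ c := (ne_of_mem_bonds hB ((hNc m).2 (Or.inr (Or.inr (Or.inl rfl))))).symm
  have hm'c : m' ≠ c := (ne_of_mem_bonds hB ((hNc m').2 (Or.inr (Or.inl rfl)))).symm
  obtain ⟨hNp, htp, -⟩ := apex_vertex hT hX1 hcard hsepX hB hBcard hdeg hcX hpX huX hNa hNc
    (fun y => (hNr y).trans or4_perm1) hBpu hBpm' hBm'm hbu'' hca hcb hBqa hac hpr hur hub hpm
    hm'q hmc hgF hgT
  obtain ⟨hNq, htq, -⟩ := apex_vertex hT hX1 hcard hsepX hB hBcard hdeg hcX hqX hu'X hNb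
    (fun y => (hNc y).trans or4_rev) (fun y => (hNr y).trans or4_perm2)
    hBqu' (by rw [Finset.pair_comm]; exact hBmq) (by rw [Finset.pair_comm]; exact hBm'm) hau hcb hca
    hBpb hbc hqr hu'r hu'a hm'q.symm hpm.symm hm'c hg'F hg'T
  exact ⟨p, q, u, u', m, m', r, ⟨hpX, hqX, huX, hu'X, hmX, hm'X, hrX⟩, hNa, hNb, hNc, hNr,
    ⟨hBpu, hBur, hBrb, hBqu', hBu'r, hBpm', hBm'm, hBmq⟩,
    ⟨hBpr, hBub, hBpb, hBqr, hBu'a, hBqa, hBpm, hBm'q, hBpq, hBuu'⟩,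
    ⟨⟨hpu, hpr, hpb, hur, hub, hrb⟩, ⟨hqu', hqr, hqa, hu'r, hu'a, hra⟩,
      ⟨hpm', hpm, hpq, hm'm, hm'q, hmq⟩, ⟨hua, hub, huu', hab', hau', hbu'⟩, hrc⟩,
    htr, hNp, hNq, htp, htq⟩

end Setting

end Summit.AtomisticToContinuum.Crystallization.Theorems
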